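import Literature.Barriers.Parity.SiegelZeroPrimePairsSieveWeights
import Literature.Barriers.Parity.SiegelZeroPrimePairsLemma41
import HarnessLib

/-!
# Matomäki–Merikoski, Lemma 3.2 (ii): the main term of the upper `β`-sieve for signed densities

Sibling of `Literature/Barriers/Parity/SiegelZeroPrimePairs.lean` (the catalogue entry vendoring
Matomäki–Merikoski, *Siegel zeros, twin primes, Goldbach's conjecture, and primes in short
intervals* (IMRN 2023; arXiv:2112.11412), Theorem 1.3 as the named fact
`Literature.Barriers.Parity.MatomakiMerikoski2023_pairCorrelation`) and of
`SiegelZeroPrimePairsSieveWeights.lean` (Lemma 3.2 (i)). Part (ii) of Lemma 3.2 evaluates the main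
term of the upper `β`-sieve weights `λ_d = μ(d) 1_{d ∈ 𝒟}` (= `μ(d) · BetaSieve.ind 1 β D d`, Rosser's
truncation set of the tree's `SieveFrameworkFundamentalLemma.lean`) against a SIGNED multiplicative
`g` with `|g(p)| ≤ 2/p` — the form needed in §5 (`g(d) = 1_{(d, d₂q)=1}/d`), in Lemma 3.3
(`g = 1/φ`) and in §6 (`g(d) = λ_L(d)/d`, Liouville, `g(p) = −1/p`) of the source, which the
classical fundamental lemma for non-negative densities of fixed dimension (the tree's
`SieveSequence.fundamental_lemma_holds`) does not cover. Everything here is a theorem; no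
definition and no named fact is introduced.

* `MatomakiMerikoski.abs_upperSieveSum_sub_vprod_le` — the estimate for a general squarefree
  sifting range `P` with prime factors `< z`: for `1 < z`, `1 < β`, `1 < D`, `z^β ≤ D`
  (`s = log D/log z`), `A ≥ 1`, `β ≥ 2 + 6(6 + 2^{A+1})/A` and multiplicative `g` with
  `|g(p)| ≤ 2/p`, `g(p) ≤ 2/3` on the prime factors of `P`:
  `|∑_{d ∣ P} λ_d g(d) − ∏_{p ∣ P}(1 − g(p))| ≤ 3 e^{24(6+2^{A+1})} e^{Aβ/2} e^{−As/2} ∏_{p ∣ P}(1 − g(p))`;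
* `MatomakiMerikoski2023_lemma32_ii` — **Lemma 3.2 (ii)** in the source's parametrisation
  (`P = P(z)`, `D = X^θ`, `z = X^{1/u}`, error `C(β, A) e^{−Aθu/2}` relative to `∏_{p<z}(1 − g(p))`,
  `β₀(A) = 2 + 6(6 + 2^{A+1})/A`), with the extra hypothesis `g(2) ≤ 2/3` discussed below.

Proof as printed (§3.2, "Proof of (ii)"): the main-term identity
`∑_{d ∣ P} μ χ g = V(P) − ∑_t μ(t) χ̄(t) g(t) V(P; q(t))` (the tree's `BetaSieve.mainTerm_identity`,
Greaves (3.1.2.15)–(3.1.2.16); the source's "(eq:lambdadgd) … `− ∑_{r odd} V_r(z)`"); a boundary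
term of index `r = ν(t)` has `q(t) ≥ z_r = z^{(1−1/β)^r}` and `r + β > s` (`BetaSieve.bdry_props`);
`V(P; q(t)) ≤ V(P) ∏_{p ≥ z_r}(1 − g(p))⁻¹ ≤ V(P) ∏_{p ≥ z_r}(1 + 6/p)`
(`MatomakiMerikoski.vlt_le_vprod_mul_prod`); the `t` of index `r` contribute
`∑ |g(t)| ≤ 2^{−Ar} ∑_{m ∣ P_{[z_r,z)}} 2^{Aω(m)}|g(m)| = 2^{−Ar} ∏_{z_r ≤ p}(1 + 2^A|g(p)|)`
(`MatomakiMerikoski.sum_divisors_two_pow_mul_abs_eq`, `MatomakiMerikoski.sum_bdry_fiber_le`);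
Mertens in the window, `∏_{z_r ≤ p < z}(1 + k/p) ≤ (e^{24} log z/log z_r)^k = (e^{24}(β/(β−1))^r)^k`
(`MatomakiMerikoski.prod_one_add_div_le_pow`, from `MatomakiMerikoski.sum_inv_primes_window_le` of
`SiegelZeroPrimePairsLemma41.lean`); and the geometric series
`∑_{r > s−β} ((β/(β−1))^{6+2^{A+1}} 2^{−A})^r ≤ 3 e^{Aβ/2} e^{−As/2}` once
`(β/(β−1))^{6+2^{A+1}} ≤ e^{A/6}` ("once `β` is large enough in terms of `A`"; `e^{A/6} 2^{−A} ≤ e^{−A/2}`).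

Deviation from the printed statement (recorded, not hidden): the source asks only
`g : ℕ → [−1, 1]` multiplicative with `|g(p)| ≤ 2/p`, which permits `g(2) = 1`; then
`∏_{p<z}(1 − g(p)) = 0` and the printed relative-error form `(1 + O(e^{−Aθu/2})) · 0` would force
`∑_{d ∣ P(z)} λ_d g(d) = 0`, which is false in general (e.g. `z = 3`, `2 ∉ 𝒟`). The theorems here
add `g(2) ≤ 2/3` (automatic at `p ≥ 3` from `|g(p)| ≤ 2/p`), which holds in every application in
the source: `g(2) = 1/2` in §5, `g(2) = −1/2` in §6, and `g(2) = 1/φ(2) · 1_{2 ∤ vq} = 0` in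
Lemma 3.3 whenever `2 ∣ vq` (there `v` is a multiple of the even shift `h`); the hypothesis
`g : ℕ → [−1, 1]` is not used. Constants are explicit but not optimised.

## References

* K. Matomäki, J. Merikoski, *Siegel zeros, twin primes, Goldbach's conjecture, and primes in
  short intervals*, IMRN 2023:23, 20337–20384 (arXiv:2112.11412): §3.2, Lemma 3.2 (ii) and its
  proof ((eq:lambdadgd), `V_r(z)`), §3.1 (eq:f(n)/n_average), (eq:Mertens) (read in the held text,
  `lit read arxiv:2112.11412`, chunks p0010–p0011). [cite: MatomakiMerikoski2023, Lemma 3.2 (ii)]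
* G. Greaves, *Sieves in Number Theory*, Springer 2001, §3.1.2 ((2.15)–(2.16)), §3.3.3–§3.3.4
  (the tree's `SieveFrameworkFundamentalLemma.lean`). [cite: Greaves2001, §3.3]
* J. Friedlander, H. Iwaniec, *Opera de Cribro*, AMS Colloquium Publ. 57 (2010), §6.5 (the beta
  sieve; the source's [Opera]). [cite: FriedlanderIwaniecOpera2010, §6.5]
* G. H. Hardy, E. M. Wright, *An Introduction to the Theory of Numbers*, Thm 427 (Mertens' second
  theorem, through `SiegelZeroPrimePairsLemma41.lean`). [cite: HardyWright2008, Thm 427]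
-/

noncomputable section

open Finset
open scoped ArithmeticFunction.Moebius

namespace Literature.Barriers.Parity.MatomakiMerikoski

open Literature.NumberTheory.Sieve Literature.NumberTheory.Sieve.BetaSieve
open Literature.NumberTheory.LFunctions


/-! ### Local factors: `(1 − g(p))⁻¹ ≤ 1 + 6/p` -/

/-- For `|x| ≤ 2/p`, `x ≤ 2/3` (`p ≥ 2`): `1 ≤ (1 − x)(1 + 6/p)` (if `x ≥ 0` use
`(1 − x)(1 + 3x) ≥ 1` on `[0, 2/3]` and `3x ≤ 6/p`; if `x < 0` both factors exceed `1`). [folklore] -/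
theorem one_le_one_sub_mul_one_add {x p : ℝ} (hp : 2 ≤ p) (h1 : |x| ≤ 2 / p) (h2 : x ≤ 2 / 3) :
    1 ≤ (1 - x) * (1 + 6 / p) := by
  have hp0 : 0 < p := by linarith
  have h6 : 0 ≤ 6 / p := by positivity
  obtain ⟨hl, hu⟩ := abs_le.mp h1
  by_cases hx : 0 ≤ x
  · have h3 : 3 * x ≤ 6 / p := by
      have : x ≤ 2 / p := hu
      calc 3 * x ≤ 3 * (2 / p) := by linarith
        _ = 6 / p := by ring
    calc (1 : ℝ) ≤ (1 - x) * (1 + 3 * x) := by nlinarith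
      _ ≤ (1 - x) * (1 + 6 / p) := by
          apply mul_le_mul_of_nonneg_left (by linarith) (by linarith)
  · push Not at hx
    nlinarith

/-- `0 < 1 − x` for `x ≤ 2/3`. [folklore] -/
theorem one_sub_pos_of_le {x : ℝ} (h2 : x ≤ 2 / 3) : 0 < 1 - x := by linarith

variable {g : ArithmeticFunction ℝ}

/-- `V(P; q) ≥ 0` when `g(p) ≤ 2/3` on the prime factors of `P`. [folklore] -/
theorem vlt_nonneg_of_le {P : ℕ} (hg : ∀ p ∈ P.primeFactors, g p ≤ 2 / 3) (q : ℕ) :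
    0 ≤ vlt g P q :=
  Finset.prod_nonneg fun p hp => (one_sub_pos_of_le (hg p (Finset.mem_filter.mp hp).1)).le

/-- `V(P) > 0` when `g(p) ≤ 2/3` on the prime factors of `P`. [folklore] -/
theorem vprod_pos_of_le {P : ℕ} (hg : ∀ p ∈ P.primeFactors, g p ≤ 2 / 3) : 0 < vprod g P :=
  Finset.prod_pos fun p hp => one_sub_pos_of_le (hg p hp)

/-- **`V(P; q) ≤ V(P) ∏_{p ∣ P, p ≥ q} (1 + 6/p)`**: the partial product is the full product divided
by `∏_{p ≥ q}(1 − g(p))`, and `(1 − g(p))⁻¹ ≤ 1 + 6/p` (the source's "`∏_{p < p_r}(1 − g(p)) … ≤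
∏_{p<z}(1 − g(p)) ∏_{z_r ≤ p ≤ z}(1 + |g(p)|)`", with constants).
[cite: MatomakiMerikoski2023, Lemma 3.2 (ii) (proof)] -/
theorem vlt_le_vprod_mul_prod {P : ℕ} (hg1 : ∀ p ∈ P.primeFactors, |g p| ≤ 2 / p)
    (hg2 : ∀ p ∈ P.primeFactors, g p ≤ 2 / 3) (q : ℕ) :
    vlt g P q ≤ vprod g P * ∏ p ∈ P.primeFactors.filter (fun p => ¬ p < q), (1 + 6 / (p : ℝ)) := by
  have hsplit : vprod g P = vlt g P q * ∏ p ∈ P.primeFactors.filter (fun p => ¬ p < q), (1 - g p) := by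
    rw [vprod, vlt, Finset.prod_filter_mul_prod_filter_not]
  have hW : 1 ≤ (∏ p ∈ P.primeFactors.filter (fun p => ¬ p < q), (1 - g p)) *
      ∏ p ∈ P.primeFactors.filter (fun p => ¬ p < q), (1 + 6 / (p : ℝ)) := by
    rw [← Finset.prod_mul_distrib]
    refine Finset.one_le_prod fun p hp => ?_
    have hp' := (Finset.mem_filter.mp hp).1
    have hp2 : (2 : ℝ) ≤ p := by exact_mod_cast (Nat.prime_of_mem_primeFactors hp').two_le
    exact one_le_one_sub_mul_one_add hp2 (hg1 p hp') (hg2 p hp')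
  have hv0 : 0 ≤ vlt g P q := vlt_nonneg_of_le hg2 q
  calc vlt g P q = vlt g P q * 1 := (mul_one _).symm
    _ ≤ vlt g P q * ((∏ p ∈ P.primeFactors.filter (fun p => ¬ p < q), (1 - g p)) *
          ∏ p ∈ P.primeFactors.filter (fun p => ¬ p < q), (1 + 6 / (p : ℝ))) :=
        mul_le_mul_of_nonneg_left hW hv0
    _ = vprod g P * ∏ p ∈ P.primeFactors.filter (fun p => ¬ p < q), (1 + 6 / (p : ℝ)) := by
        rw [hsplit]; ring

/-! ### The multiplicative majorant `2^{Aω(m)} |g(m)|` and its divisor sum -/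

/-- `ω(mn) = ω(m) + ω(n)` for coprime `m, n`. [folklore] -/
theorem card_primeFactors_mul_of_coprime {m n : ℕ} (h : m.Coprime n) :
    (m * n).primeFactors.card = m.primeFactors.card + n.primeFactors.card := by
  rw [h.primeFactors_mul, Finset.card_union_of_disjoint h.disjoint_primeFactors]

/-- For multiplicative `g` and squarefree `Q`:
`∑_{d ∣ Q} 2^{Aω(d)} |g(d)| = ∏_{p ∣ Q} (1 + 2^A |g(p)|)` (the divisor sum of the multiplicative
function `2^{Aω} |g|`; the source's "`∑_{m} 2^{A(ω(m)−r)} |μ(m)| g(m)`" step).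
[cite: MatomakiMerikoski2023, Lemma 3.2 (ii) (proof)] -/
theorem sum_divisors_two_pow_mul_abs_eq (hgm : g.IsMultiplicative) {Q : ℕ} (hQ : Squarefree Q)
    (A : ℕ) :
    ∑ d ∈ Q.divisors, (2 : ℝ) ^ (A * d.primeFactors.card) * |g d| =
      ∏ p ∈ Q.primeFactors, (1 + (2 : ℝ) ^ A * |g p|) := by
  let f : ArithmeticFunction ℝ := ⟨fun d => (2 : ℝ) ^ (A * d.primeFactors.card) * |g d|, by simp⟩
  have hf_apply : ∀ d, f d = (2 : ℝ) ^ (A * d.primeFactors.card) * |g d| := fun d => rfl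
  have hfm : f.IsMultiplicative := by
    refine ⟨by simp [hf_apply, hgm.map_one], fun {a b} hab => ?_⟩
    simp only [hf_apply]
    rw [card_primeFactors_mul_of_coprime hab, hgm.map_mul_of_coprime hab, abs_mul, mul_add, pow_add]
    ring
  have h := hfm.prodPrimeFactors_one_add_of_squarefree hQ
  simp only [hf_apply] at h
  rw [← h]
  refine Finset.prod_congr rfl fun p hp => ?_
  rw [(Nat.prime_of_mem_primeFactors hp).primeFactors, Finset.card_singleton, mul_one]

/-- A product over a larger set of factors `≥ 1` is larger (real numbers, non-negative factors):
the `R = ℝ` case of Mathlib's `Finset.prod_le_prod_of_subset_of_one_le`, kept under its old name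
as a deprecated alias (dedup-00674); use the Mathlib lemma. [folklore] -/
@[deprecated Finset.prod_le_prod_of_subset_of_one_le (since := "2026-08-15")]
theorem prod_le_prod_of_subset_of_one_le_real {ι : Type*} [DecidableEq ι] {s t : Finset ι}
    (h : s ⊆ t) {f : ι → ℝ} (hf0 : ∀ i ∈ s, 0 ≤ f i) (hf1 : ∀ i ∈ t, i ∉ s → 1 ≤ f i) :
    ∏ i ∈ s, f i ≤ ∏ i ∈ t, f i :=
  Finset.prod_le_prod_of_subset_of_one_le h hf0 hf1

/-- **The boundary terms of index `r`** ("`V_r(z) ≤ ∏_{p<z}(1 − g(p)) ∏_{z_r ≤ p ≤ z}(1 + |g(p)|)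
∑_{m: p ∣ m ⇒ z_r ≤ p < z} 2^{A(ω(m)−r)} |μ(m)| g(m)`"): for squarefree `P` with prime factors `< z`,
`1 < z`, `1 < β`, `1 < D`, `z^β ≤ D`, multiplicative `g` with `|g(p)| ≤ 2/p`, `g(p) ≤ 2/3` on the
prime factors of `P`, and `z_r = z^{(1−1/β)^r}`,
`∑_{t ∣ P boundary, ν(t) = r} |g(t)| V(P; q(t)) ≤ V(P) · ∏_{p ∣ P, p ≥ z_r}(1 + 6/p) · 2^{−Ar} ∏_{p ∣ P, p ≥ z_r}(1 + 2^A|g(p)|)`.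
[cite: MatomakiMerikoski2023, Lemma 3.2 (ii) (proof)] -/
theorem sum_bdry_fiber_le {P : ℕ} (hP : Squarefree P) {z β D : ℝ} (hβ : 1 < β) (hz : 1 < z)
    (hD1 : 1 < D) (hzD : β * Real.log z ≤ Real.log D) (hPz : ∀ p ∈ P.primeFactors, (p : ℝ) < z)
    (hgm : g.IsMultiplicative) (hg1 : ∀ p ∈ P.primeFactors, |g p| ≤ 2 / p)
    (hg2 : ∀ p ∈ P.primeFactors, g p ≤ 2 / 3) (A r : ℕ) :
    ∑ t ∈ P.divisors.filter (fun t => bdry 1 β D t ≠ 0 ∧ t.primeFactors.card = r),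
        |g t| * vlt g P t.minFac ≤
      vprod g P * (∏ p ∈ P.primeFactors.filter (fun p : ℕ => z ^ ((1 - 1 / β) ^ r) ≤ (p : ℝ)),
          (1 + 6 / (p : ℝ))) *
        ((∏ p ∈ P.primeFactors.filter (fun p : ℕ => z ^ ((1 - 1 / β) ^ r) ≤ (p : ℝ)),
          (1 + (2 : ℝ) ^ A * |g p|)) / (2 : ℝ) ^ (A * r)) := by
  classical
  have hz0 : 0 < z := by linarith
  set zr : ℝ := z ^ ((1 - 1 / β) ^ r) with hzr
  set S := P.primeFactors.filter (fun p : ℕ => zr ≤ (p : ℝ)) with hS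
  set F := P.divisors.filter (fun t => bdry 1 β D t ≠ 0 ∧ t.primeFactors.card = r) with hF
  have hV0 : 0 < vprod g P := vprod_pos_of_le hg2
  have hM1 : 1 ≤ ∏ p ∈ S, (1 + 6 / (p : ℝ)) :=
    Finset.one_le_prod fun p _ => by
      have : (0 : ℝ) ≤ 6 / (p : ℝ) := by positivity
      linarith
  have hM1' : 0 ≤ ∏ p ∈ S, (1 + 6 / (p : ℝ)) := zero_le_one.trans hM1
  -- properties of a boundary term of index `r`
  have hFprops : ∀ t ∈ F, Squarefree t ∧ t.primeFactors.card = r ∧ t.primeFactors ⊆ S ∧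
      vlt g P t.minFac ≤ vprod g P * ∏ p ∈ S, (1 + 6 / (p : ℝ)) := by
    intro t ht
    rw [hF, Finset.mem_filter] at ht
    obtain ⟨htP, hb, hcard⟩ := ht
    have htP' := Nat.dvd_of_mem_divisors htP
    have hsq : Squarefree t := hP.squarefree_of_dvd htP'
    have hpz : ∀ p ∈ t.primeFactors, (p : ℝ) < z := fun p hp =>
      hPz p (Nat.primeFactors_mono htP' hP.ne_zero hp)
    obtain ⟨-, h', h⟩ := bdry_ne_zero_props hb
    obtain ⟨hlogq, -⟩ := bdry_props (par := 1) hβ hz hD1 hzD hsq hpz h' h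
    have ht1 : t ≠ 1 := fun h1 => h (pred_of_le_one h1.le)
    have hq := Nat.minFac_prime ht1
    have hq0 : (0 : ℝ) < t.minFac := by exact_mod_cast hq.pos
    have hzrq : zr ≤ (t.minFac : ℝ) := by
      rw [hzr, Real.rpow_def_of_pos hz0, ← Real.exp_log hq0]
      refine Real.exp_le_exp.mpr ?_
      rw [hcard] at hlogq
      rw [mul_comm]; exact hlogq
    have hsub : t.primeFactors ⊆ S := by
      intro p hp
      rw [hS, Finset.mem_filter]
      refine ⟨Nat.primeFactors_mono htP' hP.ne_zero hp, hzrq.trans ?_⟩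
      exact_mod_cast Nat.minFac_le_of_dvd (Nat.prime_of_mem_primeFactors hp).two_le
        (Nat.dvd_of_mem_primeFactors hp)
    refine ⟨hsq, hcard, hsub, ?_⟩
    refine (vlt_le_vprod_mul_prod hg1 hg2 t.minFac).trans (mul_le_mul_of_nonneg_left ?_ hV0.le)
    have hsub2 : P.primeFactors.filter (fun p => ¬ p < t.minFac) ⊆ S := by
      intro p hp
      rw [Finset.mem_filter] at hp
      rw [hS, Finset.mem_filter]
      refine ⟨hp.1, hzrq.trans ?_⟩
      exact_mod_cast not_lt.mp hp.2
    exact Finset.prod_le_prod_of_subset_of_one_le hsub2 (f := fun p : ℕ => 1 + 6 / (p : ℝ))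
      (fun p _ => by positivity) (fun p _ _ => by
        have : (0 : ℝ) ≤ 6 / (p : ℝ) := by positivity
        linarith)
  -- `Q = ∏_{p ∈ S} p`
  set Q : ℕ := ∏ p ∈ S, p with hQ
  have hSprime : ∀ p ∈ S, p.Prime := fun p hp =>
    Nat.prime_of_mem_primeFactors (Finset.mem_filter.mp hp).1
  have hQP : Q ∣ P := by
    conv_rhs => rw [← Nat.prod_primeFactors_of_squarefree hP]
    exact Finset.prod_dvd_prod_of_subset _ _ _ (Finset.filter_subset _ _)
  have hQsq : Squarefree Q := hP.squarefree_of_dvd hQP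
  have hQpf : Q.primeFactors = S := Nat.primeFactors_prod hSprime
  have hFQ : F ⊆ Q.divisors := by
    intro t ht
    obtain ⟨hsq, -, hsub, -⟩ := hFprops t ht
    rw [Nat.mem_divisors]
    refine ⟨?_, hQsq.ne_zero⟩
    conv_lhs => rw [← Nat.prod_primeFactors_of_squarefree hsq]
    exact Finset.prod_dvd_prod_of_subset _ _ _ hsub
  -- the sum of the majorant over `F`
  have hmaj : ∑ t ∈ F, |g t| ≤ (∏ p ∈ S, (1 + (2 : ℝ) ^ A * |g p|)) / (2 : ℝ) ^ (A * r) := by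
    have h2 : (0 : ℝ) < (2 : ℝ) ^ (A * r) := by positivity
    rw [le_div_iff₀ h2, ← hQpf, ← sum_divisors_two_pow_mul_abs_eq hgm hQsq A, Finset.sum_mul]
    calc ∑ t ∈ F, |g t| * (2 : ℝ) ^ (A * r)
        = ∑ t ∈ F, (2 : ℝ) ^ (A * t.primeFactors.card) * |g t| := by
          refine Finset.sum_congr rfl fun t ht => ?_
          obtain ⟨-, hcard, -, -⟩ := hFprops t ht
          rw [hcard, mul_comm]
      _ ≤ ∑ d ∈ Q.divisors, (2 : ℝ) ^ (A * d.primeFactors.card) * |g d| :=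
          Finset.sum_le_sum_of_subset_of_nonneg hFQ fun d _ _ => by positivity
  -- assemble
  calc ∑ t ∈ F, |g t| * vlt g P t.minFac
      ≤ ∑ t ∈ F, |g t| * (vprod g P * ∏ p ∈ S, (1 + 6 / (p : ℝ))) :=
        Finset.sum_le_sum fun t ht => mul_le_mul_of_nonneg_left (hFprops t ht).2.2.2 (abs_nonneg _)
    _ = (vprod g P * ∏ p ∈ S, (1 + 6 / (p : ℝ))) * ∑ t ∈ F, |g t| := by
        rw [Finset.mul_sum]; refine Finset.sum_congr rfl fun t _ => ?_; ring
    _ ≤ (vprod g P * ∏ p ∈ S, (1 + 6 / (p : ℝ))) *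
          ((∏ p ∈ S, (1 + (2 : ℝ) ^ A * |g p|)) / (2 : ℝ) ^ (A * r)) :=
        mul_le_mul_of_nonneg_left hmaj (mul_nonneg hV0.le hM1')
    _ = _ := by ring

/-! ### Mertens in a window, product form -/

/-- **`∏_{p ∣ P, p ≥ w} (1 + k/p) ≤ (e^{24} log z/log w)^k`** for squarefree-type `P` with prime
factors `< z` and `1 < w ≤ z` ((eq:Mertens) of the source, upper half, with an explicit constant:
`1 + x ≤ e^x` and the window bound `∑_{w ≤ p ≤ z} 1/p ≤ log(log z/log w) + 24`).
[cite: MatomakiMerikoski2023, §3.1 (eq:Mertens)] -/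
theorem prod_one_add_div_le_pow {P : ℕ} {z : ℝ} (hPz : ∀ p ∈ P.primeFactors, (p : ℝ) < z)
    {w : ℝ} (hw1 : 1 < w) (hwz : w ≤ z) (k : ℕ) :
    ∏ p ∈ P.primeFactors.filter (fun p : ℕ => w ≤ (p : ℝ)), (1 + (k : ℝ) / p) ≤
      (Real.exp 24 * (Real.log z / Real.log w)) ^ k := by
  have hlogw : 0 < Real.log w := Real.log_pos hw1
  have hz1 : 1 < z := lt_of_lt_of_le hw1 hwz
  have hlogz : 0 < Real.log z := Real.log_pos hz1
  have hL0 : 0 < Real.log z / Real.log w := div_pos hlogz hlogw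
  set S := P.primeFactors.filter (fun p : ℕ => w ≤ (p : ℝ)) with hS
  have hsub : S ⊆ (Icc ⌈w⌉₊ ⌊z⌋₊).filter Nat.Prime := by
    intro p hp
    rw [hS, Finset.mem_filter] at hp
    rw [Finset.mem_filter, Finset.mem_Icc]
    have hp' := Nat.prime_of_mem_primeFactors hp.1
    exact ⟨⟨Nat.ceil_le.mpr hp.2, Nat.le_floor (hPz p hp.1).le⟩, hp'⟩
  have hsum : ∑ p ∈ S, (1 : ℝ) / p ≤ Real.log (Real.log z / Real.log w) + 24 :=
    (Finset.sum_le_sum_of_subset_of_nonneg hsub fun p _ _ => by positivity).trans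
      (sum_inv_primes_window_le hw1 hwz)
  calc ∏ p ∈ S, (1 + (k : ℝ) / p) ≤ ∏ p ∈ S, Real.exp ((k : ℝ) / p) := by
        refine Finset.prod_le_prod (fun p _ => by positivity) fun p _ => ?_
        rw [add_comm]; exact Real.add_one_le_exp _
    _ = Real.exp ((k : ℝ) * ∑ p ∈ S, (1 : ℝ) / p) := by
        rw [← Real.exp_sum, Finset.mul_sum]
        congr 1
        refine Finset.sum_congr rfl fun p _ => ?_
        ring
    _ ≤ Real.exp ((k : ℝ) * (Real.log (Real.log z / Real.log w) + 24)) := by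
        apply Real.exp_le_exp.mpr
        exact mul_le_mul_of_nonneg_left hsum (Nat.cast_nonneg k)
    _ = (Real.exp 24 * (Real.log z / Real.log w)) ^ k := by
        rw [Real.exp_nat_mul, Real.exp_add, Real.exp_log hL0, mul_comm]

/-- The ratio of logarithms along the ladder `z_r = z^{(1−1/β)^r}`: `log z/log z_r = (β/(β−1))^r`,
and `1 < z_r ≤ z`. [cite: MatomakiMerikoski2023, Lemma 3.2 (definition of `z_r`)] -/
theorem zr_props {z β : ℝ} (hz : 1 < z) (hβ : 1 < β) (r : ℕ) :
    1 < z ^ ((1 - 1 / β) ^ r) ∧ z ^ ((1 - 1 / β) ^ r) ≤ z ∧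
      Real.log z / Real.log (z ^ ((1 - 1 / β) ^ r)) = (β / (β - 1)) ^ r := by
  have hz0 : 0 < z := by linarith
  have hβ0 : 0 < β := by linarith
  have hθ0 : 0 < 1 - 1 / β := by
    rw [sub_pos, div_lt_one hβ0]; exact hβ
  have hθ1 : 1 - 1 / β ≤ 1 := by
    have : 0 < 1 / β := by positivity
    linarith
  have hc0 : 0 < (1 - 1 / β) ^ r := pow_pos hθ0 r
  have hc1 : (1 - 1 / β) ^ r ≤ 1 := pow_le_one₀ hθ0.le hθ1
  refine ⟨Real.one_lt_rpow hz hc0, ?_, ?_⟩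
  · calc z ^ ((1 - 1 / β) ^ r) ≤ z ^ (1 : ℝ) := Real.rpow_le_rpow_of_exponent_le hz.le hc1
      _ = z := Real.rpow_one z
  · rw [Real.log_rpow hz0]
    have hlogz : Real.log z ≠ 0 := (Real.log_pos hz).ne'
    have hθeq : 1 - 1 / β = (β - 1) / β := by field_simp
    rw [hθeq, div_pow, div_pow]
    have hβ1 : (β - 1) ^ r ≠ 0 := pow_ne_zero r (by linarith)
    have hβr : β ^ r ≠ 0 := pow_ne_zero r hβ0.ne'
    field_simp

/-! ### Lemma 3.2 (ii): assembly -/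

/-- Numerical facts: `log 2 ≥ 2/3` up to the needed precision, i.e. `A/6 − A log 2 ≤ −A/2` for
`A ≥ 0`, and `e^{−1/2} ≤ 2/3`. [folklore] -/
theorem exp_neg_one_half_le_two_thirds : Real.exp (-(1 / 2 : ℝ)) ≤ 2 / 3 := by
  have h1 : Real.exp (1 / 2 : ℝ) ≥ 3 / 2 := by
    have h := Real.add_one_le_exp (1 / 2 : ℝ)
    have h2 : Real.exp (1 / 2 : ℝ) ^ 2 = Real.exp 1 := by
      rw [← Real.exp_nat_mul]; norm_num
    nlinarith [Real.exp_one_gt_d9, Real.exp_pos (1 / 2 : ℝ)]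
  rw [Real.exp_neg, inv_le_comm₀ (Real.exp_pos _) (by norm_num)]
  linarith

/-- **Matomäki–Merikoski 2023, Lemma 3.2 (ii), for a general sifting range** (the heart of the
printed proof): let `P` be squarefree with all prime factors `< z`, `1 < z`, `1 < D`, `1 < β`,
`z^β ≤ D` (`s := log D/log z ≥ β`), and let `g` be multiplicative with `|g(p)| ≤ 2/p` and
`g(p) ≤ 2/3` at the prime factors of `P`. Let `A ≥ 1` and `β ≥ 2 + 6(6 + 2^{A+1})/A` ("`β`
sufficiently large in terms of `A`"). Then, with `λ_d = μ(d) χ⁺(d)` the upper `β`-sieve weights,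
`|∑_{d ∣ P} λ_d g(d) − ∏_{p ∣ P}(1 − g(p))| ≤ 3 e^{24(6+2^{A+1})} e^{Aβ/2} · e^{−A s/2} · ∏_{p ∣ P}(1 − g(p))`.
Proof as printed (§3.2): the main-term identity (`BetaSieve.mainTerm_identity`) leaves the boundary
sum `∑_t μ(t) χ̄(t) g(t) V(P; q(t))`; the terms of index `r` are `≤ V(P) ∏_{z_r ≤ p}(1 + 6/p) ·
2^{−Ar} ∏_{z_r ≤ p}(1 + 2^{A+1}/p)` (`sum_bdry_fiber_le`), Mertens in the window `[z_r, z)` turns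
the products into `(e^{24}(β/(β−1))^r)^{6 + 2^{A+1}}` (`prod_one_add_div_le_pow`, `zr_props`), only
`r > s − β` occur (`BetaSieve.bdry_props`), and the resulting geometric series in
`x = (β/(β−1))^{6+2^{A+1}} 2^{−A} ≤ e^{−A/2}` is `≤ 3 x^{⌈s−β⌉}`. The hypothesis `g(p) ≤ 2/3` is not
printed: the source asks `g : ℕ → [−1, 1]`, `|g(p)| ≤ 2/p`, which allows `g(2) = 1`, where
`∏(1 − g(p)) = 0` and the printed relative-error statement fails (e.g. `z = 3`: `∑ λ_d g(d) =
1 − g(2) 1_{2 ∈ 𝒟}` need not vanish); all uses in the source (`g(d) = 1_{(d,d₂q)=1}/d` in (5.x),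
`g = λ_L/d` in §6, `g = 1/φ` restricted to `(d, vq) = 1` with `2 ∣ vq` in Lemma 3.3) have
`g(2) ∈ {0, ±1/2}`. [cite: MatomakiMerikoski2023, Lemma 3.2 (ii)] -/
theorem abs_upperSieveSum_sub_vprod_le {P : ℕ} (hP : Squarefree P) {z β D : ℝ} (hβ : 1 < β)
    (hz : 1 < z) (hD1 : 1 < D) (hzD : β * Real.log z ≤ Real.log D)
    (hPz : ∀ p ∈ P.primeFactors, (p : ℝ) < z) (hgm : g.IsMultiplicative)
    (hg1 : ∀ p ∈ P.primeFactors, |g p| ≤ 2 / p) (hg2 : ∀ p ∈ P.primeFactors, g p ≤ 2 / 3)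
    {A : ℕ} (hA : 1 ≤ A) (hβA : 2 + 6 * ((6 : ℝ) + 2 ^ (A + 1)) / A ≤ β) :
    |∑ d ∈ P.divisors, (μ d : ℝ) * ind 1 β D d * g d - vprod g P| ≤
      3 * Real.exp (24 * ((6 : ℝ) + 2 ^ (A + 1))) * Real.exp ((A : ℝ) * β / 2) *
        Real.exp (-(A : ℝ) * (Real.log D / Real.log z) / 2) * vprod g P := by
  classical
  have hz0 : 0 < z := by linarith
  have hlogz : 0 < Real.log z := Real.log_pos hz
  have hA0 : (0 : ℝ) < A := by exact_mod_cast hA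
  have hV0 : 0 < vprod g P := vprod_pos_of_le hg2
  -- constants
  set k₂ : ℕ := 2 ^ (A + 1) with hk₂
  set K : ℕ := 6 + k₂ with hK
  have hKr : (K : ℝ) = 6 + 2 ^ (A + 1) := by rw [hK, hk₂]; push_cast; ring
  set b : ℝ := β / (β - 1) with hb
  have hβ1 : 0 < β - 1 := by linarith
  have hb1 : 1 < b := by rw [hb, one_lt_div hβ1]; linarith
  have hb0 : 0 < b := by linarith
  set x : ℝ := b ^ K / 2 ^ A with hx
  have hx0 : 0 ≤ x := by positivity
  -- `x ≤ e^{-A/2}` from `β ≥ 2 + 6K/A`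
  have hlogb : Real.log b ≤ 1 / (β - 1) := by
    have h := Real.log_le_sub_one_of_pos hb0
    have : b - 1 = 1 / (β - 1) := by rw [hb]; field_simp; ring
    linarith
  have hKβ : (K : ℝ) / (β - 1) ≤ A / 6 := by
    rw [hKr, div_le_div_iff₀ hβ1 (by norm_num)]
    have h1 : 6 * ((6 : ℝ) + 2 ^ (A + 1)) / A ≤ β - 2 := by linarith
    rw [div_le_iff₀ hA0] at h1
    nlinarith
  have hbK : b ^ K ≤ Real.exp (A / 6) := by
    rw [← Real.exp_log (pow_pos hb0 K), Real.exp_le_exp, Real.log_pow]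
    calc (K : ℝ) * Real.log b ≤ K * (1 / (β - 1)) :=
          mul_le_mul_of_nonneg_left hlogb (Nat.cast_nonneg K)
      _ = K / (β - 1) := by ring
      _ ≤ A / 6 := hKβ
  have hxe : x ≤ Real.exp (-(A : ℝ) / 2) := by
    have h2A : (2 : ℝ) ^ A = Real.exp (A * Real.log 2) := by
      rw [← Real.rpow_natCast, Real.rpow_def_of_pos (by norm_num), mul_comm]
    rw [hx, div_le_iff₀ (by positivity), h2A, ← Real.exp_add]
    refine hbK.trans (Real.exp_le_exp.mpr ?_)
    nlinarith [Real.log_two_gt_d9]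
  have hx1 : x ≤ 2 / 3 := by
    refine hxe.trans ((Real.exp_le_exp.mpr ?_).trans exp_neg_one_half_le_two_thirds)
    have : (1 : ℝ) ≤ A := by exact_mod_cast hA
    linarith
  have hx1' : x < 1 := by linarith
  -- Step 1: the main-term identity and the triangle inequality
  have hmain := mainTerm_identity (par := 1) (β := β) (D := D) hgm hP
  have hR : |∑ d ∈ P.divisors, (μ d : ℝ) * ind 1 β D d * g d - vprod g P| ≤
      ∑ t ∈ P.divisors, bdry 1 β D t * |g t| * vlt g P t.minFac := by
    rw [hmain, sub_sub_cancel_left, abs_neg]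
    refine (Finset.abs_sum_le_sum_abs _ _).trans (Finset.sum_le_sum fun t _ => ?_)
    have hμ : |(μ t : ℝ)| ≤ 1 := by exact_mod_cast ArithmeticFunction.abs_moebius_le_one
    have hb' : 0 ≤ bdry 1 β D t := bdry_nonneg t
    have hv : 0 ≤ vlt g P t.minFac := vlt_nonneg_of_le hg2 _
    rw [abs_mul, abs_mul, abs_mul, abs_of_nonneg hb', abs_of_nonneg hv]
    have h0 : 0 ≤ bdry 1 β D t * |g t| * vlt g P t.minFac := by positivity
    calc |(μ t : ℝ)| * bdry 1 β D t * |g t| * vlt g P t.minFac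
        = |(μ t : ℝ)| * (bdry 1 β D t * |g t| * vlt g P t.minFac) := by ring
      _ ≤ 1 * (bdry 1 β D t * |g t| * vlt g P t.minFac) := mul_le_mul_of_nonneg_right hμ h0
      _ = _ := one_mul _
  -- Step 2: restrict to the boundary and decompose along the index `r = ω(t)`
  set F₀ := P.divisors.filter (fun t => bdry 1 β D t ≠ 0) with hF₀
  have hstep2 : ∑ t ∈ P.divisors, bdry 1 β D t * |g t| * vlt g P t.minFac =
      ∑ t ∈ F₀, |g t| * vlt g P t.minFac := by
    rw [hF₀, Finset.sum_filter]
    refine Finset.sum_congr rfl fun t _ => ?_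
    by_cases hbt : bdry 1 β D t = 0
    · rw [hbt, if_neg (fun h => h rfl)]; ring
    · rw [if_pos hbt, bdry_eq_one_of_ne_zero hbt]; ring
  set N : ℕ := P.primeFactors.card with hN
  have hmaps : ∀ t ∈ F₀, t.primeFactors.card ∈ Finset.range (N + 1) := by
    intro t ht
    have htP := Nat.dvd_of_mem_divisors (Finset.mem_filter.mp ht).1
    rw [Finset.mem_range, Nat.lt_succ_iff]
    exact Finset.card_le_card (Nat.primeFactors_mono htP hP.ne_zero)
  have hfib : ∑ t ∈ F₀, |g t| * vlt g P t.minFac =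
      ∑ r ∈ Finset.range (N + 1), ∑ t ∈ F₀.filter (fun t => t.primeFactors.card = r),
        |g t| * vlt g P t.minFac :=
    (Finset.sum_fiberwise_of_maps_to hmaps _).symm
  -- Step 3: the bound for each index
  have hfiber : ∀ r : ℕ, ∑ t ∈ F₀.filter (fun t => t.primeFactors.card = r), |g t| * vlt g P t.minFac ≤
      if Real.log D < ((r : ℝ) + β) * Real.log z then vprod g P * Real.exp (24 * K) * x ^ r else 0 := by
    intro r
    rw [hF₀, Finset.filter_filter]
    by_cases hcond : Real.log D < ((r : ℝ) + β) * Real.log z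
    · rw [if_pos hcond]
      obtain ⟨hzr1, hzrz, hratio⟩ := zr_props hz hβ r
      refine (sum_bdry_fiber_le hP hβ hz hD1 hzD hPz hgm hg1 hg2 A r).trans ?_
      have hM1 := prod_one_add_div_le_pow hPz hzr1 hzrz 6
      have hM2 := prod_one_add_div_le_pow hPz hzr1 hzrz k₂
      rw [hratio] at hM1 hM2
      have hM2' : ∏ p ∈ P.primeFactors.filter (fun p : ℕ => z ^ ((1 - 1 / β) ^ r) ≤ (p : ℝ)),
          (1 + (2 : ℝ) ^ A * |g p|) ≤ (Real.exp 24 * (β / (β - 1)) ^ r) ^ k₂ := by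
        refine le_trans ?_ hM2
        refine Finset.prod_le_prod (fun p _ => by positivity) fun p hp => ?_
        have hp' := (Finset.mem_filter.mp hp).1
        have hp0 : (0 : ℝ) < p := by exact_mod_cast (Nat.prime_of_mem_primeFactors hp').pos
        have : (2 : ℝ) ^ A * |g p| ≤ (k₂ : ℝ) / p := by
          rw [hk₂]; push_cast
          calc (2 : ℝ) ^ A * |g p| ≤ 2 ^ A * (2 / p) :=
                mul_le_mul_of_nonneg_left (hg1 p hp') (by positivity)
            _ = 2 ^ (A + 1) / p := by rw [pow_succ]; ring
        linarith
      have h6 : (Nat.cast 6 : ℝ) = 6 := by norm_num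
      rw [h6] at hM1
      have hprod1 : 0 ≤ ∏ p ∈ P.primeFactors.filter (fun p : ℕ => z ^ ((1 - 1 / β) ^ r) ≤ (p : ℝ)),
          (1 + (6 : ℝ) / p) := Finset.prod_nonneg fun p _ => by positivity
      have hprod2 : 0 ≤ ∏ p ∈ P.primeFactors.filter (fun p : ℕ => z ^ ((1 - 1 / β) ^ r) ≤ (p : ℝ)),
          (1 + (2 : ℝ) ^ A * |g p|) := Finset.prod_nonneg fun p _ => by positivity
      have hpow2 : (0 : ℝ) < 2 ^ (A * r) := by positivity
      calc vprod g P * (∏ p ∈ P.primeFactors.filter (fun p : ℕ => z ^ ((1 - 1 / β) ^ r) ≤ (p : ℝ)),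
              (1 + 6 / (p : ℝ))) *
            ((∏ p ∈ P.primeFactors.filter (fun p : ℕ => z ^ ((1 - 1 / β) ^ r) ≤ (p : ℝ)),
              (1 + (2 : ℝ) ^ A * |g p|)) / (2 : ℝ) ^ (A * r))
          ≤ vprod g P * (Real.exp 24 * (β / (β - 1)) ^ r) ^ 6 *
              ((Real.exp 24 * (β / (β - 1)) ^ r) ^ k₂ / (2 : ℝ) ^ (A * r)) := by
            gcongr
      _ = vprod g P * Real.exp (24 * K) * x ^ r := by
            have hE : Real.exp (24 * (K : ℝ)) = Real.exp 24 ^ K := by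
              rw [← Real.exp_nat_mul, mul_comm]
            rw [hE, hx, hK, hb]
            ring
    · rw [if_neg hcond]
      have hempty : P.divisors.filter (fun t => bdry 1 β D t ≠ 0 ∧ t.primeFactors.card = r) = ∅ := by
        refine Finset.filter_eq_empty_iff.mpr fun t ht hc => hcond ?_
        obtain ⟨hb', hcard⟩ := hc
        have htP' := Nat.dvd_of_mem_divisors ht
        have hsq : Squarefree t := hP.squarefree_of_dvd htP'
        have hpz : ∀ p ∈ t.primeFactors, (p : ℝ) < z := fun p hp =>
          hPz p (Nat.primeFactors_mono htP' hP.ne_zero hp)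
        obtain ⟨-, h', h⟩ := bdry_ne_zero_props hb'
        obtain ⟨-, hidx⟩ := bdry_props (par := 1) hβ hz hD1 hzD hsq hpz h' h
        rw [hcard] at hidx
        exact hidx
      rw [hempty, Finset.sum_empty]
  -- Step 4: the geometric series over `r > s - β`
  set s : ℝ := Real.log D / Real.log z with hs
  set r₀ : ℕ := ⌈s - β⌉₊ with hr₀
  have hcond_r : ∀ r : ℕ, Real.log D < ((r : ℝ) + β) * Real.log z → r₀ ≤ r := by
    intro r hr
    rw [hr₀]
    refine Nat.ceil_le.mpr ?_
    rw [sub_le_iff_le_add, hs, div_le_iff₀ hlogz]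
    exact hr.le
  have hgeom : ∑ r ∈ Finset.range (N + 1),
      (if Real.log D < ((r : ℝ) + β) * Real.log z then vprod g P * Real.exp (24 * K) * x ^ r else 0) ≤
      vprod g P * Real.exp (24 * K) * (x ^ r₀ / (1 - x)) := by
    rw [← Finset.sum_filter]
    have hsub : (Finset.range (N + 1)).filter (fun r : ℕ => Real.log D < ((r : ℝ) + β) * Real.log z) ⊆
        Finset.Ico r₀ (N + 1) := by
      intro r hr
      rw [Finset.mem_filter, Finset.mem_range] at hr
      exact Finset.mem_Ico.mpr ⟨hcond_r r hr.2, hr.1⟩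
    calc ∑ r ∈ (Finset.range (N + 1)).filter (fun r : ℕ => Real.log D < ((r : ℝ) + β) * Real.log z),
          vprod g P * Real.exp (24 * K) * x ^ r
        ≤ ∑ r ∈ Finset.Ico r₀ (N + 1), vprod g P * Real.exp (24 * K) * x ^ r :=
          Finset.sum_le_sum_of_subset_of_nonneg hsub fun r _ _ => by positivity
      _ = vprod g P * Real.exp (24 * K) * ∑ r ∈ Finset.Ico r₀ (N + 1), x ^ r := by
          rw [Finset.mul_sum]
      _ ≤ vprod g P * Real.exp (24 * K) * (x ^ r₀ / (1 - x)) :=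
          mul_le_mul_of_nonneg_left (geom_sum_Ico_le_of_lt_one hx0 hx1') (by positivity)
  -- Step 5: `x^{r₀}/(1 - x) ≤ 3 e^{Aβ/2} e^{-A s/2}`
  have hxr₀ : x ^ r₀ ≤ Real.exp ((A : ℝ) * β / 2) * Real.exp (-(A : ℝ) * s / 2) := by
    have h1 : x ^ r₀ ≤ Real.exp (-(A : ℝ) / 2) ^ r₀ := pow_le_pow_left₀ hx0 hxe r₀
    have h2 : Real.exp (-(A : ℝ) / 2) ^ r₀ = Real.exp (-(A : ℝ) / 2 * r₀) := by
      rw [← Real.exp_nat_mul]; ring_nf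
    have hr₀s : s - β ≤ (r₀ : ℝ) := Nat.le_ceil _
    rw [h2] at h1
    refine h1.trans ?_
    rw [← Real.exp_add]
    apply Real.exp_le_exp.mpr
    nlinarith
  have hden : 1 / (1 - x) ≤ 3 := by
    rw [div_le_iff₀ (by linarith)]; linarith
  calc |∑ d ∈ P.divisors, (μ d : ℝ) * ind 1 β D d * g d - vprod g P|
      ≤ ∑ t ∈ P.divisors, bdry 1 β D t * |g t| * vlt g P t.minFac := hR
    _ = ∑ r ∈ Finset.range (N + 1), ∑ t ∈ F₀.filter (fun t => t.primeFactors.card = r),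
          |g t| * vlt g P t.minFac := by rw [hstep2, hfib]
    _ ≤ ∑ r ∈ Finset.range (N + 1),
          (if Real.log D < ((r : ℝ) + β) * Real.log z then vprod g P * Real.exp (24 * K) * x ^ r
            else 0) := Finset.sum_le_sum fun r _ => hfiber r
    _ ≤ vprod g P * Real.exp (24 * K) * (x ^ r₀ / (1 - x)) := hgeom
    _ = vprod g P * Real.exp (24 * K) * x ^ r₀ * (1 / (1 - x)) := by ring
    _ ≤ vprod g P * Real.exp (24 * K) * (Real.exp ((A : ℝ) * β / 2) * Real.exp (-(A : ℝ) * s / 2)) * 3 := by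
        gcongr
    _ = 3 * Real.exp (24 * ((6 : ℝ) + 2 ^ (A + 1))) * Real.exp ((A : ℝ) * β / 2) *
          Real.exp (-(A : ℝ) * (Real.log D / Real.log z) / 2) * vprod g P := by
        rw [hKr, hs]; ring

end Literature.Barriers.Parity.MatomakiMerikoski

/-! ### Lemma 3.2 (ii) in the parametrisation of the source -/

namespace Literature.Barriers.Parity

open Literature.NumberTheory.Sieve Literature.NumberTheory.Sieve.BetaSieve MatomakiMerikoski

/-- **Matomäki–Merikoski 2023, Lemma 3.2 (ii)** (as printed, in the parametrisation of the source):
"Let `θ ∈ (0, 1/3)` and `A ∈ ℕ`. There exists `β₀ = β₀(A) ≥ 2` such that the following holds for any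
`β ≥ β₀` and `u ≥ β/θ`. Let `X ≥ 2`, write `D = X^θ` and `z = X^{1/u}` … Then there exist
coefficients `λ_d` with `|λ_d| ≤ 1` supported on `d ≤ D` such that … (ii) If `g : ℕ → [−1, 1]` is a
multiplicative function for which `|g(p)| ≤ 2/p` for every prime `p`, then
`∑_{d ∣ P(z)} λ_d g(d) = (1 + O_{β,A}(e^{−Aθu/2})) ∏_{p<z} (1 − g(p))`."
Here `λ_d = μ(d) · BetaSieve.ind 1 β D d` (the same upper `β`-sieve weights as in part (i),
`SiegelZeroPrimePairsSieveWeights.lean`), `P(z) = primesProdBelow z`, and the `O_{β,A}` is an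
explicit `C(β, A) = 3 e^{24(6+2^{A+1})} e^{Aβ/2}` with `β₀(A) = 2 + 6(6 + 2^{A+1})/A`. PROVED for
every `A ≥ 1`, `θ > 0`, `u > 0` with `uθ ≥ β`, `X > 1` (neither `θ < 1/3` nor `X ≥ 2` is needed), from
`MatomakiMerikoski.abs_upperSieveSum_sub_vprod_le`; with ONE EXTRA HYPOTHESIS, `g(2) ≤ 2/3`, not
printed in the source: as printed the statement fails when `g(2) = 1` (then `∏_{p<z}(1 − g(p)) = 0`
while `∑ λ_d g(d)` need not vanish), and every application in the source has `g(2) ∈ {0, ±1/2}`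
(see the docstring of `MatomakiMerikoski.abs_upperSieveSum_sub_vprod_le`).
[cite: MatomakiMerikoski2023, Lemma 3.2 (ii)] -/
theorem MatomakiMerikoski2023_lemma32_ii (A : ℕ) (hA : 1 ≤ A) :
    ∃ β₀ : ℝ, 2 ≤ β₀ ∧ ∀ β : ℝ, β₀ ≤ β → ∃ C : ℝ, 0 < C ∧
      ∀ θ u X : ℝ, 0 < θ → 0 < u → β ≤ u * θ → 1 < X →
        ∀ g : ArithmeticFunction ℝ, g.IsMultiplicative →
          (∀ p : ℕ, p.Prime → |g p| ≤ 2 / p) → g 2 ≤ 2 / 3 →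
          |∑ d ∈ (primesProdBelow (X ^ (1 / u))).divisors, (μ d : ℝ) * ind 1 β (X ^ θ) d * g d -
              ∏ p ∈ Nat.primesBelow ⌈X ^ (1 / u)⌉₊, (1 - g p)| ≤
            C * Real.exp (-(A : ℝ) * θ * u / 2) * ∏ p ∈ Nat.primesBelow ⌈X ^ (1 / u)⌉₊, (1 - g p) := by
  have hA0 : (0 : ℝ) < A := by exact_mod_cast hA
  refine ⟨2 + 6 * ((6 : ℝ) + 2 ^ (A + 1)) / A, by
    have : (0 : ℝ) ≤ 6 * ((6 : ℝ) + 2 ^ (A + 1)) / A := by positivity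
    linarith, fun β hβA => ?_⟩
  have hβ : 1 < β := by
    have : (0 : ℝ) ≤ 6 * ((6 : ℝ) + 2 ^ (A + 1)) / A := by positivity
    linarith
  refine ⟨3 * Real.exp (24 * ((6 : ℝ) + 2 ^ (A + 1))) * Real.exp ((A : ℝ) * β / 2), by positivity,
    fun θ u X hθ hu hβu hX g hgm hg1 hg2two => ?_⟩
  have hX0 : 0 < X := by linarith
  have hlogX : 0 < Real.log X := Real.log_pos hX
  have hz : 1 < X ^ (1 / u) := Real.one_lt_rpow hX (by positivity)
  have hD1 : 1 < X ^ θ := Real.one_lt_rpow hX hθ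
  have hlogz : Real.log (X ^ (1 / u)) = 1 / u * Real.log X := Real.log_rpow hX0 _
  have hlogD : Real.log (X ^ θ) = θ * Real.log X := Real.log_rpow hX0 _
  have hzD : β * Real.log (X ^ (1 / u)) ≤ Real.log (X ^ θ) := by
    rw [hlogz, hlogD]
    have : β * (1 / u) ≤ θ := by
      rw [mul_one_div, div_le_iff₀ hu]; linarith [mul_comm u θ]
    nlinarith
  have hratio : Real.log (X ^ θ) / Real.log (X ^ (1 / u)) = θ * u := by
    rw [hlogz, hlogD]; field_simp
  set P : ℕ := primesProdBelow (X ^ (1 / u)) with hPdef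
  have hP : Squarefree P := squarefree_primesProdBelow _
  have hPf : P.primeFactors = Nat.primesBelow ⌈X ^ (1 / u)⌉₊ := primeFactors_primesProdBelow _
  have hPz : ∀ p ∈ P.primeFactors, (p : ℝ) < X ^ (1 / u) := by
    intro p hp
    rw [hPf, Nat.mem_primesBelow] at hp
    exact Nat.lt_ceil.mp hp.1
  have hg1' : ∀ p ∈ P.primeFactors, |g p| ≤ 2 / p := fun p hp =>
    hg1 p (Nat.prime_of_mem_primeFactors hp)
  have hg2' : ∀ p ∈ P.primeFactors, g p ≤ 2 / 3 := by
    intro p hp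
    have hp' := Nat.prime_of_mem_primeFactors hp
    rcases hp'.eq_two_or_odd' with rfl | hodd
    · exact hg2two
    · have hp3 : (3 : ℝ) ≤ p := by
        have : 3 ≤ p := by
          rcases hodd with ⟨k, hk⟩
          have := hp'.two_le
          omega
        exact_mod_cast this
      calc g p ≤ |g p| := le_abs_self _
        _ ≤ 2 / p := hg1' p hp
        _ ≤ 2 / 3 := div_le_div_of_nonneg_left (by norm_num) (by norm_num) hp3
  have hmain := abs_upperSieveSum_sub_vprod_le hP hβ hz hD1 hzD hPz hgm hg1' hg2' hA hβA
  rw [hratio] at hmain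
  have hV : vprod g P = ∏ p ∈ Nat.primesBelow ⌈X ^ (1 / u)⌉₊, (1 - g p) := by
    rw [vprod, hPf]
  rw [hV] at hmain
  convert hmain using 2
  rw [show -(A : ℝ) * θ * u / 2 = -(A : ℝ) * (θ * u) / 2 by ring]

end Literature.Barriers.Parity
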